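import Summits.QuantumFields.BalabanUV.Beta.CompositeCorrectorKernel
import Summits.QuantumFields.BalabanUV.Beta.CompositeCorrectorLinear
import Summits.QuantumFields.BalabanUV.Beta.DiagonalContact

/-!
# `BalabanUV.Beta.FP.CompositeLinearKernelExpansion` — road «FP» for binder row D1, ROUTE T: **THE COMPOSITE ROOTED LINEAR AVERAGING AS A KERNEL FUNCTIONAL** —
# piece (W1) of the F4 assembly (leaf-02 g29 W-7, HOME/CLAIMS.log l.55655): K-U3d's UNNORMALISED composite average `compLinAvgAt r L n B (l, z)` IS
# `(L^{d+1})^n · Σ'_w Σ_m c n (m, w) (l, z) · B m w` for ANY kernel `c` obeying the TOP-PEELED linear recursion over an1's NORMALISED rooted brick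
# `linKerAt (toSite (r m)) L` on a window `Ω` covering `Near` (an2 F3's `compLinKer` SHAPE: `c 0 f g = [g = f]`, `c (m+1) f g = Σ_κ Σ_{e ∈ Ω} linKerAt … g (κ, L•g.2+e) ·
# c m f (κ, L•g.2+e)`) — the kernel expansion `hCf` that R-13 `CompositeKernelFunctionalStep.pairing_of_kernel_succ` consumes, with the unit `#box^n = (L^{d+1})^n` displayed

WHY.  R-13 turns the kernel recursion into R-7's `hsucc` given the kernel expansions `hCf ∕ hAf` of the lower average `S′ · compLinAvgAt …` and of the top `linAvgAt`;
an2's F3 (`Beta/CompositeVertexKernelRec`, p372081) defines the coefficient recursion `compLinKer ℓ L` over abstract bricks.  THIS file supplies the bridge for the bricks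
of record: §1 ONE STEP — `linAvgAt (toSite r) B L κ z = L^{d+1} · Σ_{κ′} Σ_{e ∈ Ω} linKerAt (toSite r) L κ z (κ′, L•z+e) · B κ′ (L•z+e)` (`r ∈ box`, `1 ≤ L`; K-U3d
`apply_eq_sum_of_depOn` + `depOn_linAvgAt` + `DiagonalContact.linAvgAt_delta1_eq_pow_mul_linKerAt`; the window `Ω` any finite set of offsets covering an1's `Near`,
e.g. an2's `offs L` by `near_iff_exists_offs`); §2 THE COMPOSITE by induction, for any `c` with the recursion (`hc0 ∕ hcsucc`) and a finite support in the fine bond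
(`hcS`).  [folklore] finite sums + finitely supported `tsum`s BY NAME; no `def`, no `def … : Prop`, nothing cited, 0 sorry; nothing of Bałaban's asserted.
NOT HERE: an2's `compLinKer` itself (instantiate `c := compLinKer (fun m => linKerAt (toSite (r m)) L) L`, `hcsucc := compLinKer_succ`, `hcS := compLinKer_eq_zero`).

HONEST DEPENDENCY (page 1, mandatory): continuum YM on T⁴ ⇐ BetaPertH ∧ nine spine estimates (0/9 proved); BetaPertH ⇐ (D1) ∧ (D4) ∧ CAP+tail;
G-an2-4 gates asym, D1 and NE2/3/4.  HONEST FRAMING (cell contract, verbatim): «discharging `BetaPertH` makes Bałaban's UV stability UNCONDITIONAL —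
a real constructive-QFT result; it is NOT the continuum limit and NOT the Clay problem.»  ABSOLUTE RULE (cell charter, verbatim): «No internally-minted
statement may enter as a cited fact. Every hypothesis is either kernel-proved in this package or a verbatim quotation of a PUBLISHED theorem with page
reference. The manuscript(s) under audit are NOT citable for their own disputed steps — they are the thing under adjudication; programme-internal
(2001/route/tribunal) claims are never citable.»  0 estimates; 0∕4 row-D1 binders (hW, hR, D1Tel, D1Rep); NOT (T-ID), NOT (C1), NOT SDF, NOT D1,
NOT BetaPertH, NOT continuum, NOT Clay.  D1 formalisation swarm LEAF PROVER 02 (b2b-balaban-beta-d1-formalise-leaf-02 gen 29), 2026-08-23.  No existing file touched.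
-/

noncomputable section

open scoped BigOperators

namespace Summit.QuantumFields.BalabanUV.Beta.FP.CompositeLinearKernelExpansion

open Finset
open Literature.MathematicalPhysics.QuantumFieldTheory
open Literature.MathematicalPhysics.QuantumFieldTheory.Balaban1983to89
open Literature.MathematicalPhysics.QuantumFieldTheory.Balaban1983to89.Beta
open AffineAveraging (Site Form1 box toSite unitVec)
open AveragingContours (blk)
open AveragingContoursRooted (linAvgAt)
open AveragingHessianKernels (Bond Near)
open AveragingHessianKernelsRooted (linKerAt)
open KKTFluctuationKernel (delta1)
open Summit.QuantumFields.BalabanUV.Beta.CompositeAveragingCoarseExact (compLinAvgAt)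
open Summit.QuantumFields.BalabanUV.Beta.CompositeCorrectorLocality (DepOn InPair InPairBond depOn_linAvgAt le_of_blk lt_of_blk)
open Summit.QuantumFields.BalabanUV.Beta.CompositeCorrectorKernel (indR indR_apply apply_eq_sum_of_depOn)
open Summit.QuantumFields.BalabanUV.Beta.CompositeCorrectorForms (linAvgAt_sub')
open Summit.QuantumFields.BalabanUV.Beta.CompositeCorrectorLinear (linAvgAt_smul)
open Summit.QuantumFields.BalabanUV.Beta.BorderedHessian (linAvgAt_delta1_eq_pow_mul_linKerAt)

variable {d : ℕ}

/-! ## §1 One step: the rooted linear averaging as a window sum against an1's normalised kernel -/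

/-- [folklore] the block pair of a coarse bond lies in an1's `Near` window of its base site (`1 ≤ L`). -/
theorem near_of_inPair {L : ℕ} (hL : 1 ≤ L) {κ : Fin (d + 1)} {z w : Site (d + 1)} (hw : w ∈ InPair L κ z) : Near L z w := by
  intro i
  obtain ⟨h1, h2⟩ := hw i
  have h3 := le_of_blk (show 0 < L from hL) w i
  have h4 := lt_of_blk (show 0 < L from hL) w i
  have h5 : blk L w i ≤ z i + 1 := le_trans h2 (by split_ifs <;> omega)
  constructor <;> nlinarith

/-- [folklore] the rooted linear averaging is linear on finite combinations (K-U3d `apply_eq_sum_of_depOn`'s letter). -/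
theorem linAvgAt_finset_smul_sum (ρ : Site (d + 1)) (L : ℕ) (s : Finset (Fin (d + 1) × Site (d + 1))) (c : Fin (d + 1) × Site (d + 1) → ℝ)
    (B : Fin (d + 1) × Site (d + 1) → Form1 (d + 1) ℝ) :
    (linAvgAt ρ (∑ i ∈ s, c i • B i) L : Form1 (d + 1) ℝ) = ∑ i ∈ s, c i • (linAvgAt ρ (B i) L : Form1 (d + 1) ℝ) := by
  classical
  induction s using Finset.induction_on with
  | empty =>
      funext μ y
      simp only [Finset.sum_empty]
      have h := linAvgAt_sub' ρ (0 : Form1 (d + 1) ℝ) 0 L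
      rw [sub_self, sub_self] at h
      exact congrFun (congrFun h μ) y
  | insert i s hi ih =>
      funext μ y
      rw [Finset.sum_insert hi, Finset.sum_insert hi]
      have hadd : (linAvgAt ρ (c i • B i + ∑ j ∈ s, c j • B j) L : Form1 (d + 1) ℝ)
          = linAvgAt ρ (c i • B i) L + linAvgAt ρ (∑ j ∈ s, c j • B j) L := by
        have h := linAvgAt_sub' ρ (c i • B i + ∑ j ∈ s, c j • B j) (∑ j ∈ s, c j • B j) L
        rw [add_sub_cancel_right] at h
        rw [h, sub_add_cancel]
      rw [hadd, Pi.add_apply, Pi.add_apply, ih, Pi.add_apply, Pi.add_apply, Pi.smul_apply, Pi.smul_apply, smul_eq_mul, linAvgAt_smul]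

/-- [folklore] K-U3d's bond indicator is an1's delta form. -/
theorem indR_eq_delta1 (β : Fin (d + 1)) (y : Site (d + 1)) : indR β y = delta1 β y := by
  funext κ z
  rw [indR_apply, KKTFluctuationKernel.delta1_apply]

/-- [folklore] **ONE STEP — THE ROOTED LINEAR AVERAGING AS A WINDOW SUM AGAINST an1's NORMALISED KERNEL**: for an in-block root `r ∈ box`, `1 ≤ L`, and any finite
window of offsets `Ω` covering `Near` (`hΩ`),
`linAvgAt (toSite r) B L κ z = L^{d+1} · Σ_{κ′} Σ_{e ∈ Ω} linKerAt (toSite r) L κ z (κ′, L•z + e) · B κ′ (L•z + e)`. -/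
theorem linAvgAt_eq_pow_mul_window_sum {L : ℕ} [NeZero L] (hL : 1 ≤ L) {r : Fin (d + 1) → ℕ} (hr : r ∈ box (d + 1) L)
    (Ω : Finset (Site (d + 1))) (hΩ : ∀ y x : Site (d + 1), Near L y x → ∃ e ∈ Ω, x = (L : ℤ) • y + e)
    (B : Form1 (d + 1) ℝ) (κ : Fin (d + 1)) (z : Site (d + 1)) :
    linAvgAt (toSite r) B L κ z
      = (L : ℝ) ^ (d + 1) * ∑ κ' : Fin (d + 1), ∑ e ∈ Ω, linKerAt (toSite r) L κ z (κ', (L : ℤ) • z + e) * B κ' ((L : ℤ) • z + e) := by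
  classical
  have hinj : Function.Injective fun e : Site (d + 1) => (L : ℤ) • z + e := fun a b h => add_left_cancel h
  have hPS : ∀ p ∈ InPairBond L κ z, p ∈ (Finset.univ : Finset (Fin (d + 1))) ×ˢ Ω.image (fun e : Site (d + 1) => (L : ℤ) • z + e) := by
    rintro ⟨κ', w⟩ ⟨hw, -⟩
    obtain ⟨e, he, hwe⟩ := hΩ z w (near_of_inPair hL hw)
    exact Finset.mem_product.2 ⟨Finset.mem_univ _, Finset.mem_image.2 ⟨e, he, hwe.symm⟩⟩
  have h := apply_eq_sum_of_depOn (T := fun A => (linAvgAt (toSite r) A L : Form1 (d + 1) ℝ)) (α := κ) (x := z)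
    (depOn_linAvgAt hL hr κ z) hPS (fun s c Bs => linAvgAt_finset_smul_sum (toSite r) L s c Bs) B
  rw [h, Finset.sum_product, Finset.mul_sum]
  refine Finset.sum_congr rfl fun κ' _ => ?_
  rw [Finset.sum_image fun a _ b _ hab => hinj hab, Finset.mul_sum]
  refine Finset.sum_congr rfl fun e _ => ?_
  show linAvgAt (toSite r) (indR κ' ((L : ℤ) • z + e)) L κ z * B κ' ((L : ℤ) • z + e) = _
  rw [indR_eq_delta1, linAvgAt_delta1_eq_pow_mul_linKerAt, mul_assoc]

/-! ## §2 The composite: any kernel obeying the top-peeled linear recursion represents `compLinAvgAt` -/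

/-- [folklore] plumbing: a finite window combination of finitely supported kernel functionals is the kernel functional of the combination. -/
theorem sum_sum_mul_tsum_sum_eq (Ω : Finset (Site (d + 1))) (a : Fin (d + 1) → Site (d + 1) → ℝ)
    (K : Fin (d + 1) → Site (d + 1) → Fin (d + 1) → Site (d + 1) → ℝ) (S : Fin (d + 1) → Site (d + 1) → Finset (Site (d + 1)))
    (hK : ∀ κ e (m : Fin (d + 1)), ∀ w ∉ S κ e, K κ e m w = 0) (B : Form1 (d + 1) ℝ) :
    ∑ κ : Fin (d + 1), ∑ e ∈ Ω, a κ e * (∑' w : Site (d + 1), ∑ m : Fin (d + 1), K κ e m w * B m w)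
      = ∑' w : Site (d + 1), ∑ m : Fin (d + 1), (∑ κ : Fin (d + 1), ∑ e ∈ Ω, a κ e * K κ e m w) * B m w := by
  have hsum : ∀ κ e, Summable fun w : Site (d + 1) => a κ e * ∑ m : Fin (d + 1), K κ e m w * B m w := fun κ e =>
    summable_of_ne_finset_zero (s := S κ e) fun w hw => by
      rw [Finset.sum_eq_zero fun m _ => by rw [hK κ e m w hw, zero_mul], mul_zero]
  have hsum' : ∀ κ, Summable fun w : Site (d + 1) => ∑ e ∈ Ω, a κ e * ∑ m : Fin (d + 1), K κ e m w * B m w := fun κ =>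
    summable_sum fun e _ => hsum κ e
  symm
  calc (∑' w : Site (d + 1), ∑ m : Fin (d + 1), (∑ κ : Fin (d + 1), ∑ e ∈ Ω, a κ e * K κ e m w) * B m w)
      = ∑' w : Site (d + 1), ∑ κ : Fin (d + 1), ∑ e ∈ Ω, a κ e * ∑ m : Fin (d + 1), K κ e m w * B m w := by
        refine tsum_congr fun w => ?_
        rw [Finset.sum_congr rfl fun m _ => Finset.sum_mul _ _ _, Finset.sum_comm]
        refine Finset.sum_congr rfl fun κ _ => ?_
        rw [Finset.sum_congr rfl fun m _ => Finset.sum_mul _ _ _, Finset.sum_comm]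
        exact Finset.sum_congr rfl fun e _ => by rw [Finset.mul_sum]; exact Finset.sum_congr rfl fun m _ => by ring
    _ = ∑ κ : Fin (d + 1), ∑' w : Site (d + 1), ∑ e ∈ Ω, a κ e * ∑ m : Fin (d + 1), K κ e m w * B m w := Summable.tsum_finsetSum fun κ _ => hsum' κ
    _ = ∑ κ : Fin (d + 1), ∑ e ∈ Ω, ∑' w : Site (d + 1), a κ e * ∑ m : Fin (d + 1), K κ e m w * B m w :=
        Finset.sum_congr rfl fun κ _ => Summable.tsum_finsetSum fun e _ => hsum κ e
    _ = ∑ κ : Fin (d + 1), ∑ e ∈ Ω, a κ e * (∑' w : Site (d + 1), ∑ m : Fin (d + 1), K κ e m w * B m w) :=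
        Finset.sum_congr rfl fun κ _ => Finset.sum_congr rfl fun e _ => tsum_mul_left

/-- [folklore] **THE COMPOSITE ROOTED LINEAR AVERAGING AS A KERNEL FUNCTIONAL** (piece (W1) of the F4 assembly).  For `1 ≤ L`, in-block roots `r k ∈ box`, a finite
offset window `Ω` covering `Near`, and ANY kernel `c : ℕ → Bond → Bond → ℝ` (fine bond, coarse bond) obeying an2 F3's `compLinKer` recursion over the brick
`linKerAt (toSite (r m)) L` — `hc0 : c 0 f g = [g = f]`, `hcsucc : c (m+1) f g = Σ_κ Σ_{e ∈ Ω} linKerAt (toSite (r m)) L g.1 g.2 (κ, L•g.2+e) · c m f (κ, L•g.2+e)` — with a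
finite support in the fine bond (`hcS`): for every depth `n`, form `B` and coarse bond `g`,
`compLinAvgAt r L n B g.1 g.2 = (L^{d+1})^n · Σ'_w Σ_m c n (m, w) g · B m w`. -/
theorem compLinAvgAt_eq_pow_mul_tsum {L : ℕ} [NeZero L] (hL : 1 ≤ L) (r : ℕ → (Fin (d + 1) → ℕ)) (hr : ∀ k, r k ∈ box (d + 1) L)
    (Ω : Finset (Site (d + 1))) (hΩ : ∀ y x : Site (d + 1), Near L y x → ∃ e ∈ Ω, x = (L : ℤ) • y + e)
    (c : ℕ → Bond (d + 1) → Bond (d + 1) → ℝ) (hc0 : ∀ f g : Bond (d + 1), c 0 f g = if g = f then 1 else 0)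
    (hcsucc : ∀ (m : ℕ) (f g : Bond (d + 1)), c (m + 1) f g
      = ∑ κ : Fin (d + 1), ∑ e ∈ Ω, linKerAt (toSite (r m)) L g.1 g.2 (κ, (L : ℤ) • g.2 + e) * c m f (κ, (L : ℤ) • g.2 + e))
    (S : ℕ → Bond (d + 1) → Finset (Site (d + 1))) (hcS : ∀ (m : ℕ) (f g : Bond (d + 1)), f.2 ∉ S m g → c m f g = 0) :
    ∀ (n : ℕ) (B : Form1 (d + 1) ℝ) (g : Bond (d + 1)),
      compLinAvgAt r L n B g.1 g.2 = ((L : ℝ) ^ (d + 1)) ^ n * ∑' w : Site (d + 1), ∑ m : Fin (d + 1), c n (m, w) g * B m w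
  | 0, B, g => by
      classical
      show B g.1 g.2 = _
      rw [pow_zero, one_mul]
      have hw : ∀ w : Site (d + 1), w ≠ g.2 → (∑ m : Fin (d + 1), c 0 (m, w) g * B m w) = 0 := fun w hw =>
        Finset.sum_eq_zero fun m _ => by
          rw [hc0, if_neg, zero_mul]
          intro h
          exact hw (by rw [h])
      rw [tsum_eq_single g.2 hw, Finset.sum_eq_single g.1 (fun m _ hm => by rw [hc0, if_neg (fun h => hm (by rw [h])), zero_mul])
        (fun h => (h (Finset.mem_univ _)).elim), hc0, if_pos rfl, one_mul]
  | n + 1, B, g => by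
      show linAvgAt (toSite (r n)) (compLinAvgAt r L n B) L g.1 g.2 = _
      rw [linAvgAt_eq_pow_mul_window_sum hL (hr n) Ω hΩ (compLinAvgAt r L n B) g.1 g.2]
      -- the lower average by the induction hypothesis, at each window bond
      rw [Finset.sum_congr rfl fun κ _ => Finset.sum_congr rfl fun e _ => by
        rw [show compLinAvgAt r L n B κ ((L : ℤ) • g.2 + e) = compLinAvgAt r L n B (κ, (L : ℤ) • g.2 + e).1 (κ, (L : ℤ) • g.2 + e).2 from rfl,
          compLinAvgAt_eq_pow_mul_tsum hL r hr Ω hΩ c hc0 hcsucc S hcS n B (κ, (L : ℤ) • g.2 + e), ← mul_assoc, mul_comm (linKerAt _ _ _ _ _), mul_assoc]]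
      rw [Finset.sum_congr rfl fun κ _ => (Finset.mul_sum _ _ _).symm, ← Finset.mul_sum, ← mul_assoc, ← pow_succ']
      congr 1
      rw [sum_sum_mul_tsum_sum_eq Ω (fun κ e => linKerAt (toSite (r n)) L g.1 g.2 (κ, (L : ℤ) • g.2 + e))
        (fun κ e m w => c n (m, w) (κ, (L : ℤ) • g.2 + e)) (fun κ e => S n (κ, (L : ℤ) • g.2 + e)) (fun κ e m w hw => hcS n (m, w) _ hw) B]
      exact tsum_congr fun w => Finset.sum_congr rfl fun m _ => by rw [hcsucc n (m, w) g]

end Summit.QuantumFields.BalabanUV.Beta.FP.CompositeLinearKernelExpansion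

end
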